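import Summits.AnomalousDissipation.AnomalousDissipation.Theorems.BaireTransferDenseLoudDesignerForcesErgodicInvariantCore
import Summits.AnomalousDissipation.AnomalousDissipation.Theorems.BaireTransferDenseLoudDesignerForcesErgodicModelDefs
import Summits.AnomalousDissipation.AnomalousDissipation.Theorems.BaireTransferDenseLoudDesignerForcesErgodicModelFrameExists
import Summits.AnomalousDissipation.AnomalousDissipation.Theorems.BaireTransferDenseLoudDesignerForcesErgodicFramePreimage
import Summits.AnomalousDissipation.AnomalousDissipation.Theorems.BaireTransferDenseLoudDesignerForcesErgodicModelTube
import Summits.AnomalousDissipation.AnomalousDissipation.Theorems.BaireTransferDenseLoudDesignerForcesErgodicModelSemigroup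
import Summits.AnomalousDissipation.AnomalousDissipation.Theorems.BaireTransferDenseLoudDesignerForcesErgodicModelCoreDynamics
import Summits.AnomalousDissipation.AnomalousDissipation.Theorems.BaireTransferDenseLoudDesignerForcesErgodicModelMeasureCore
import Summits.AnomalousDissipation.AnomalousDissipation.Theorems.BaireTransferDenseLoudDesignerForcesErgodicModelCoreCompactFrame
import Summits.AnomalousDissipation.AnomalousDissipation.Theorems.BaireTransferDenseLoudDesignerForcesErgodicModelIterate
import Summits.AnomalousDissipation.AnomalousDissipation.Theorems.BaireTransferDenseLoudDesignerForcesErgodicEnlargedPhase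
import Summits.AnomalousDissipation.AnomalousDissipation.Theorems.BaireTransferDenseLoudDesignerForcesErgodicModel
import Summits.AnomalousDissipation.AnomalousDissipation.Theorems.BaireTransferDenseLoudDesignerForcesErgodicJointSmoothness
import Summits.AnomalousDissipation.AnomalousDissipation.Theorems.BaireTransferDenseLoudDesignerForcesErgodicMildFlowDerivativesContinuity
import Summits.AnomalousDissipation.AnomalousDissipation.Theorems.BaireTransferDenseLoudDesignerForcesErgodicDiagonalSemigroupCalculus
import Summits.AnomalousDissipation.AnomalousDissipation.Theorems.BaireTransferDenseLoudDesignerForcesErgodicTubeOrbitClassical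
import Summits.AnomalousDissipation.AnomalousDissipation.Theorems.BaireTransferDenseLoudDesignerForcesErgodicClosedOrbitClassical
import Summits.AnomalousDissipation.AnomalousDissipation.Theorems.BaireTransferDenseLoudDesignerForcesErgodicModelTimeDerivativeFields
import Summits.AnomalousDissipation.AnomalousDissipation.Theorems.BaireTransferDenseLoudDesignerForcesErgodicModelDerivativeCompactInjective
import Summits.AnomalousDissipation.AnomalousDissipation.Theorems.BaireTransferDenseLoudDesignerForcesErgodicHyperbolicityTransfer
import Summits.AnomalousDissipation.AnomalousDissipation.Theorems.BaireTransferDenseLoudDesignerForcesErgodicModelMixedDerivativeField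

/-!
# THE SMOOTH MODEL OF THE NAVIER–STOKES PHASE — block N of the line `ergodic-budget-selection-closing`
# (crux `BaireTransfer.DenseLoudDesignerForces`, stmt-AnomalousDissipation-1143): the registered composition stub `stub_smoothModel`

For an NS phase `(K, φ)` of the designer force `f_c` at `ν > 0`, an invariant probability measure `μ` carried by `K`, and the
classical hyperbolicity hypothesis `IsHyperbolicMeasure`, this file ASSEMBLES the smooth model required by the closing argument:
an enlarged phase `(K', φ')` (`stub_enlargedPhaseTools`, P1), the frame `Smap = F.S = (1+A)^{-1/2}` of a `ModelFrame`
(`stub_modelFrameExistsTools`), the open tube `U ⊇ Λ := F.S ⁻¹' K_c` around the `μ`-full strongly invariant compact core `K_c`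
(`stub_invariantCoreTools`, `stub_modelTubeTools`), the MODEL MAP `g := F.modelMap ν xF U'` (mild solutions of the frame-conjugated
equation, `…ErgodicModelDefs`), and the pulled-back measure `m` (`stub_modelMeasureCoreTools`), and proves
`IsHyperbolicSemiflowModel U Λ g m ∧ IsSmoothModelOf K' φ' μ F.S U Λ g m` field by field from the landed tools stubs of the line
(N-programme §9c in the crux directory):

* topology/dynamics: `stub_modelCoreCompactFrameTools` (Λ compact, `F.S '' Λ = K_c`), `stub_modelCoreDynamicsTools` (mapsTo/surjOn/injOn),
  `stub_modelSemigroupTools` (exact local semigroup law), `stub_modelIterateTools` (continuity of all iterates on Λ; periodic orbits);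
* analysis: joint continuity (`stub_modelTubeTools`), joint `C²` on `(0,2) × U` (`stub_jointSmoothnessTools` over the partial-derivative
  fields `stub_modelTimeDerivativeFieldsTools`, `stub_modelMixedDerivativeFieldTools` and the abstract `stub_mildFlowDerivativesContinuityTools`,
  instantiated here through the `[0,3]`-curve packaging of the tube — `nfinal_yFields`), compact and injective derivatives
  (`stub_modelDerivativeCompactInjectiveTools`), classical orbits (`stub_tubeOrbitClassicalTools`);
* measure and hyperbolicity: `stub_modelMeasureCoreTools`, `stub_hyperbolicityTransferTools`;
* the phase-enlargement guarantee `closedOrbit`: `stub_closedOrbitClassicalTools` + the membership clause of P1 (`nfinal_closedOrbit`).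

No new definitions; no sorry; axioms standard.  This closes the composition stub N of the registered skeleton; the crux itself stays
open (stub 1′ is the open problem ⊇ stmt-AnomalousDissipation-1149; stub D is promoted).
-/

set_option linter.dupNamespace false

noncomputable section

open Filter Set Function MeasureTheory Metric
open scoped Topology ContDiff InnerProductSpace RealInnerProductSpace ENNReal

namespace Summit.AnomalousDissipation.AnomalousDissipation.Theorems.DenseLoudDesignerForces.Ergodic

open Literature.Analysis.FunctionSpaces Literature.Analysis.FunctionSpaces.Torus
open Literature.Analysis.FluidPDE Literature.Analysis.FluidPDE.Torus
open Summit.AnomalousDissipation.AnomalousDissipation.Theses.BaireTransfer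
open Summit.AnomalousDissipation.AnomalousDissipation.Theorems.DenseLoudDesignerForces.Negative
open Literature.Dynamics.Hyperbolic



/-- N-final glue: the `y`-side fields of S4b from T6 through the `[0,3]`-curve packaging of the tube. [folklore] -/
theorem nfinal_yFields (F : ModelFrame) {ν : ℝ} (hν : 0 < ν) (xF : Hsp) {U U' : Set Hsp} (hU : IsOpen U)
    (htube : ∀ y ∈ U, ∀ t ∈ Icc (0 : ℝ) 3, ∃ (ht : 0 ≤ t) (z : C(Icc (0 : ℝ) t, Hsp)),
      F.IsMild ν xF ht y z ∧ (∀ r, z r ∈ U') ∧ F.modelMap ν xF U' t y = z ⟨t, ht, le_rfl⟩)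
    (hcont : ContinuousOn (fun q : ℝ × Hsp => F.modelMap ν xF U' q.1 q.2) (Icc (0 : ℝ) 3 ×ˢ U))
    (hsmooth : ∀ t ∈ Icc (0 : ℝ) 3, ContDiffOn ℝ ∞ (fun y => F.modelMap ν xF U' t y) U) :
    ContinuousOn (fun q : ℝ × Hsp => fderiv ℝ (fun y => F.modelMap ν xF U' q.1 y) q.2) (Ioc (0 : ℝ) 3 ×ˢ U) ∧
      ContinuousOn (fun q : ℝ × Hsp => fderiv ℝ (fun y => fderiv ℝ (fun y' => F.modelMap ν xF U' q.1 y') y) q.2) (Ioo (0 : ℝ) 3 ×ˢ U) := by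
  have h3 : (0 : ℝ) ≤ 3 := by norm_num
  have h3' : (3 : ℝ) ∈ Icc (0 : ℝ) 3 := ⟨h3, le_rfl⟩
  -- the `[0,3]`-curve packaging of the tube
  have hcurve : ∀ y ∈ U, ∃ z : C(Icc (0 : ℝ) 3, Hsp), F.IsMild ν xF h3 y z ∧ (∀ r, z r ∈ U') ∧
      ∀ s : Icc (0 : ℝ) 3, F.modelMap ν xF U' s y = z s := by
    intro y hy
    have h := htube y hy 3 h3'
    rcases h with ⟨h0, z, hz, hzU, -⟩
    refine ⟨z, hz, hzU, fun s => ?_⟩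
    have hres := hz.restrict s.2.1 s.2.2
    rcases hres with ⟨z', hz', hz'eq⟩
    have h1 := F.modelMap_eq_of_isMild hν s.2.1 hz' (fun r => by rw [hz'eq]; exact hzU _)
    have h2 := hz'eq ⟨s, right_mem_Icc.2 s.2.1⟩
    exact h1.trans h2
  choose! G hzc using hcurve
  have hGg : ∀ y ∈ U, ∀ s : Icc (0 : ℝ) 3, G y s = F.modelMap ν xF U' s y := fun y hy s => ((hzc y hy).2.2 s).symm
  -- operator-norm continuity of the frame families
  obtain ⟨-, -, -, -, -, -, -, -, hTn, hKn, -, -, -⟩ := stub_diagonalSemigroupCalculusTools F.ι F.b F.m F.hpos F.T F.K F.hT F.hK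
  have hνmap : MapsTo (fun t : ℝ => ν * t) (Ioi 0) (Ioi 0) := fun t ht => mul_pos hν ht
  have hTn' : ContinuousOn (fun t : ℝ => F.T (ν * t)) (Ioi 0) := hTn.comp (continuous_const.mul continuous_id).continuousOn hνmap
  have hKn' : ContinuousOn (fun t : ℝ => F.K (ν * t)) (Ioi 0) := hKn.comp (continuous_const.mul continuous_id).continuousOn hνmap
  -- continuity of the packaging into `C(Icc 0 3, Hsp)`
  have hGc : ContinuousOn G U := by
    rw [continuousOn_iff_continuous_restrict]
    have hΦ : Continuous (fun q : U × Icc (0 : ℝ) 3 => F.modelMap ν xF U' (q.2 : ℝ) (q.1 : Hsp)) := by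
      have h := hcont.comp_continuous (f := fun q : U × Icc (0 : ℝ) 3 => ((q.2 : ℝ), (q.1 : Hsp)))
        (by fun_prop) (fun q => mk_mem_prod q.2.2 q.1.2)
      exact h
    have hcurry := (ContinuousMap.curry ⟨_, hΦ⟩).continuous
    refine hcurry.congr fun y => ContinuousMap.ext fun s => ?_
    simp only [ContinuousMap.curry_apply, ContinuousMap.coe_mk, restrict_apply]
    exact (hGg y y.2 s).symm
  -- per-time smoothness and the mild identity of the packaging
  have hGs : ∀ t : Icc (0 : ℝ) 3, ContDiffOn ℝ ∞ (fun y => G y t) U := fun t =>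
    (hsmooth t t.2).congr fun y hy => hGg y hy t
  have hGm : ∀ y ∈ U, ∀ t : Icc (0 : ℝ) 3, G y t = (fun t => F.T (ν * t)) t y +
      (∫ s in (0 : ℝ)..(t : ℝ), (fun t => F.T (ν * t)) ((t : ℝ) - s) xF) -
      ∫ s in (0 : ℝ)..(t : ℝ), (fun t => F.K (ν * t)) ((t : ℝ) - s)
        (F.Nb (G y (Set.projIcc 0 3 h3 s)) (G y (Set.projIcc 0 3 h3 s))) := fun y hy t => (hzc y hy).1 t
  obtain ⟨hc1, hc2, -⟩ := stub_mildFlowDerivativesContinuityTools (fun t => F.T (ν * t)) (fun t => F.K (ν * t))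
    (F.T_mul_zero ν) (F.T_mul_add hν.le) (F.norm_T_mul_le hν.le) (F.continuous_T_mul ν) hTn'
    (by norm_num : (0 : ℝ) ≤ 3 / 4) (by norm_num : (3 / 4 : ℝ) < 1) (Real.rpow_nonneg hν.le _) (F.norm_K_mul_le hν)
    (F.K_mul_add hν) (F.continuousOn_K_mul hν) hKn' F.Nb xF (by norm_num : (0 : ℝ) < 3) hU G hGc hGs hGm
  -- transfer to the model map through the local agreement on the open `U`
  have hfd : ∀ q ∈ Ioc (0 : ℝ) 3 ×ˢ U, ∀ y' ∈ U,
      fderiv ℝ (fun y => G y (Set.projIcc 0 3 h3 q.1)) y' = fderiv ℝ (fun y => F.modelMap ν xF U' q.1 y) y' := by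
    intro q hq y' hy'
    refine Filter.EventuallyEq.fderiv_eq ?_
    filter_upwards [hU.mem_nhds hy'] with y hy
    rw [hGg y hy, Set.projIcc_of_mem h3 ⟨hq.1.1.le, hq.1.2⟩]
  refine ⟨hc1.congr fun q hq => (hfd q hq q.2 hq.2).symm, (hc2.mono (prod_mono Ioo_subset_Ioc_self subset_rfl)).congr ?_⟩
  intro q hq
  have hq' : q ∈ Ioc (0 : ℝ) 3 ×ˢ U := ⟨Ioo_subset_Ioc_self hq.1, hq.2⟩
  refine (Filter.EventuallyEq.fderiv_eq ?_).symm
  filter_upwards [hU.mem_nhds hq.2] with y hy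
  exact hfd q hq' y hy

/-- N-final glue: closed model orbits are carried onto trajectories of the enlarged phase (field `closedOrbit`), from the uniform
classical description of closed orbits (S6g), the membership clause of the enlarged phase (P1), `map_zero` (S6b) and orbit periodicity (S6i).
[folklore] -/
theorem nfinal_closedOrbit {S : Finset (Fin 3 → ℤ)} {c : ↥S → (EuclideanSpace ℂ (Fin 3))} (F : ModelFrame) {ν : ℝ}
    (xF : Hsp) {U U' : Set Hsp} (hUU' : U ⊆ U') (hzero : ∀ y ∈ U', F.modelMap ν xF U' 0 y = y)
    (hper : ∀ z ∈ U, ∀ T : ℝ, 0 < T → (∀ t ∈ Icc 0 T, F.modelMap ν xF U' t z ∈ U) → F.modelMap ν xF U' T z = z →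
      ∀ t : ℝ, 0 ≤ t → F.modelMap ν xF U' (t + T) z = F.modelMap ν xF U' t z ∧ F.modelMap ν xF U' t z ∈ U)
    {R : ℝ} (hR : ∀ z ∈ U, ∀ T : ℝ, 0 < T → (∀ t ∈ Icc 0 T, F.modelMap ν xF U' t z ∈ U) → F.modelMap ν xF U' T z = z →
      ∃ (u : ℝ → (UnitAddTorus (Fin 3)) → (EuclideanSpace ℝ (Fin 3))) (p : ℝ → (UnitAddTorus (Fin 3)) → ℝ),
        IsClassicalNSSolutionOn univ ν (fun _ => force S c) u p ∧ (∀ t, HasZeroMean (u t)) ∧ Function.Periodic u T ∧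
        (∀ t, gradNormSq (u t) ≤ R) ∧ ∀ t ∈ Icc 0 T, F.S (F.modelMap ν xF U' t z) = stateOf (u t))
    {K' : Set Hsp} {φ' : ℝ → Hsp → Hsp} (hK' : IsNSPhase ν (force S c) K' φ')
    (hmem : ∀ (u : ℝ → (UnitAddTorus (Fin 3)) → (EuclideanSpace ℝ (Fin 3))) (p : ℝ → (UnitAddTorus (Fin 3)) → ℝ),
        IsClassicalNSSolutionOn (Ici 0) ν (fun _ => force S c) u p → (∀ t : ℝ, 0 ≤ t → HasZeroMean (u t)) →
        (∀ t : ℝ, 0 ≤ t → gradNormSq (u t) ≤ R) →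
        ∀ s : ℝ, 1 ≤ s → ∃ x ∈ K', ∀ t : ℝ, 0 ≤ t → rep (φ' t x) =ᵐ[volume] u (s + t)) :
    ∀ z ∈ U, ∀ T : ℝ, 0 < T → (∀ t ∈ Icc 0 T, F.modelMap ν xF U' t z ∈ U) → F.modelMap ν xF U' T z = z →
      F.S z ∈ K' ∧ ∀ t : ℝ, 0 ≤ t → φ' t (F.S z) = F.S (F.modelMap ν xF U' t z) := by
  intro z hz T hT horb hfix
  obtain ⟨u, p, hsol, hmean, hperu, hgrad, himg⟩ := hR z hz T hT horb hfix
  have hsol0 : IsClassicalNSSolutionOn (Ici 0) ν (fun _ => force S c) u p := hsol.mono (subset_univ _) (uniqueDiffOn_Ici 0)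
  -- a period multiple `s = k T ≥ 1`
  obtain ⟨k, hk⟩ : ∃ k : ℕ, (1 : ℝ) ≤ k * T := by
    refine ⟨⌈1 / T⌉₊, ?_⟩
    have h1 : 1 / T ≤ ⌈1 / T⌉₊ := Nat.le_ceil _
    calc (1 : ℝ) = 1 / T * T := by field_simp
      _ ≤ ⌈1 / T⌉₊ * T := by gcongr
  have hperk : Function.Periodic u (k * T) := hperu.nat_mul k
  obtain ⟨x, hxK', hx⟩ := hmem u p hsol0 (fun t _ => hmean t) (fun t _ => hgrad t) (k * T) hk
  have hx' : ∀ t : ℝ, 0 ≤ t → rep (φ' t x) =ᵐ[volume] u t := fun t ht => by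
    have h := hx t ht
    rwa [add_comm, hperk] at h
  -- smoothness data of the slices
  have hsm : ∀ t, IsSmooth (u t) := fun t => hsol.smooth_velocity.isSmooth_slice (mem_univ t)
  have hdf : ∀ t, IsDivFree (u t) := fun t => hsol.divFree t (mem_univ t)
  -- `x = [u 0] = F.S z`
  have hx0 : x = stateOf (u 0) := by
    have h := hx' 0 le_rfl
    rw [hK'.map_zero x hxK'] at h
    exact eq_stateOf_of_rep_ae_eq x (hsm 0) (hdf 0) h
  have hz0 : F.S z = stateOf (u 0) := by
    have h := himg 0 ⟨le_rfl, hT.le⟩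
    rwa [hzero z (hUU' hz)] at h
  have hxz : F.S z = x := hz0.trans hx0.symm
  refine ⟨hxz ▸ hxK', fun t ht => ?_⟩
  -- reduce `t` modulo the period on the model side
  obtain ⟨n, hn⟩ : ∃ n : ℕ, (n * T : ℝ) ≤ t ∧ t < n * T + T := by
    refine ⟨⌊t / T⌋₊, ?_, ?_⟩
    · have := Nat.floor_le (by positivity : 0 ≤ t / T)
      calc (⌊t / T⌋₊ : ℝ) * T ≤ t / T * T := by gcongr
        _ = t := by field_simp
    · have h1 := Nat.lt_floor_add_one (t / T)
      have h2 : t = t / T * T := by field_simp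
      nlinarith
  have hred : ∀ n : ℕ, ∀ t' : ℝ, 0 ≤ t' → F.modelMap ν xF U' (t' + n * T) z = F.modelMap ν xF U' t' z := by
    intro n
    induction n with
    | zero => intro t' _; simp
    | succ n ih =>
      intro t' ht'
      have h0 : 0 ≤ t' + n * T := by have := hT.le; positivity
      have h1 := (hper z hz T hT horb hfix (t' + n * T) h0).1
      have h2 : t' + (n + 1 : ℕ) * T = t' + n * T + T := by push_cast; ring
      rw [h2, h1, ih t' ht']
  set t' := t - n * T with ht'def
  have ht'0 : 0 ≤ t' := by rw [ht'def]; linarith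
  have ht'T : t' ≤ T := by rw [ht'def]; linarith
  have hgt : F.modelMap ν xF U' t z = F.modelMap ν xF U' t' z := by
    have h := hred n t' ht'0
    have : t' + n * T = t := by rw [ht'def]; ring
    rwa [this] at h
  have hut : u t = u t' := by
    have h := hperu.nat_mul n t'
    have : t' + n * T = t := by rw [ht'def]; ring
    rw [← this, ← h]
  rw [hgt, himg t' ⟨ht'0, ht'T⟩, ← hut, hxz]
  exact eq_stateOf_of_rep_ae_eq (φ' t x) (hsm t) (hdf t) (hx' t ht)

/-- **The smooth model of the Navier–Stokes phase** (registered composition stub `stub_smoothModel` of the crux skeleton, block N):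
an enlarged NS phase `(K', φ')` agreeing with `φ` on `K ⊆ K'`, an injective frame `Smap`, an open `U ⊇ Λ`, a local semiflow `g` and a
probability measure `m` with `IsHyperbolicSemiflowModel U Λ g m` and `IsSmoothModelOf K' φ' μ Smap U Λ g m` — assembled from the landed
tools stubs of the line (see the module docstring). [folklore] -/
theorem stub_smoothModel {S : Finset (Fin 3 → ℤ)} {c : ↥S → (EuclideanSpace ℂ (Fin 3))} {ν : ℝ} {K : Set Hsp} {φ : ℝ → Hsp → Hsp}
    {μ : Measure Hsp} (hν : 0 < ν) (hK : IsNSPhase ν (force S c) K φ) (hμ : IsInvariantMeasure K φ μ)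
    (hH : IsHyperbolicMeasure ν (force S c) φ μ) :
    ∃ (K' : Set Hsp) (φ' : ℝ → Hsp → Hsp) (Smap : Hsp →L[ℝ] Hsp) (U Λ : Set Hsp) (g : ℝ → Hsp → Hsp) (m : Measure Hsp),
      K ⊆ K' ∧ (∀ t : ℝ, 0 ≤ t → ∀ x ∈ K, φ' t x = φ t x) ∧ IsNSPhase ν (force S c) K' φ' ∧
        IsHyperbolicSemiflowModel U Λ g m ∧ IsSmoothModelOf K' φ' μ Smap U Λ g m := by
  classical
  -- §1 the μ-full strongly invariant compact core
  obtain ⟨Kc, hKcK, hKc, hKcsub, hmapsφ, hsurjφ, -, hinvμ⟩ := stub_invariantCoreTools hK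
  have hinv : ∀ t : ℝ, 0 ≤ t → φ t '' Kc = Kc := fun t ht =>
    (hmapsφ t ht).image_subset.antisymm (hsurjφ t ht)
  -- §2 a model frame
  obtain ⟨ι, b, m, Sop, Top, Kop, Nb, hpos, htend, hA, hmodes, hS, hSinj, hT, hTnorm, hT0, hTadd, hTc, hTS, hTsa, hKb, hKnorm,
    hKadd, hKS, hKcont, hNb⟩ := stub_modelFrameExistsTools
  let F : ModelFrame := ⟨ι, b, m, Sop, Top, Kop, Nb, hpos, htend, hA, hmodes, hS, hSinj, hT, hTnorm, hT0, hTadd, hTc, hTS, hTsa,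
    hKb, hKnorm, hKadd, hKS, hKcont, hNb⟩
  -- §3 the frame forcing
  obtain ⟨hfs, hfd, hfm⟩ := stub_designerForceTools S c
  obtain ⟨xF, hxF⟩ : ∃ xF : Hsp, F.S xF = stateOf (force S c) :=
    ⟨_, stub_framePreimageTools F.ι F.b F.m F.hmodes F.S F.hS hfs hfd hfm⟩
  -- §4 the tube of the model map around the core
  obtain ⟨U, U', hU, hU', hbdd, hΛU, hUU', htube, hcont, hsmooth, hconj⟩ :=
    stub_modelTubeTools hν hK F xF hxF hKcK hKc hinv
  have htube' : ∀ y ∈ U, ∀ t ∈ Icc (0 : ℝ) 3, ∃ (ht : 0 ≤ t) (z : C(Icc (0 : ℝ) t, Hsp)),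
      F.IsMild ν xF ht y z ∧ ∀ r, z r ∈ U' := fun y hy t ht => by
    obtain ⟨ht', z, hz, hzU, -⟩ := htube y hy t ht
    exact ⟨ht', z, hz, hzU⟩
  -- §5 compactness of the core preimage and its image
  obtain ⟨hΛc, hSΛ⟩ := stub_modelCoreCompactFrameTools hν hK F hKc one_pos (hKcsub 1 zero_le_one)
  -- §6 exact local semigroup law; dynamics on the core preimage
  obtain ⟨hzero, hadd⟩ := stub_modelSemigroupTools F hν xF hUU' htube'
  have hdyn := stub_modelCoreDynamicsTools hν hK F hKcK hinv (g := F.modelMap ν xF U') hconj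
  -- §7 continuity of all iterates on the core preimage; periodic orbits
  obtain ⟨hiter, hper⟩ := stub_modelIterateTools F hν xF hUU' htube' hcont
  have hcontΛ : ∀ t : ℝ, 0 ≤ t → ContinuousOn (F.modelMap ν xF U' t) (F.S ⁻¹' Kc) :=
    hiter _ hΛU fun t ht => (hdyn t ht).1
  -- §8 the model measure
  have hμc : IsInvariantMeasure (F.S '' (F.S ⁻¹' Kc)) φ μ := by rw [hSΛ]; exact hinvμ μ hμ
  obtain ⟨mm, hprob, hnullΛ, hmapg, hmapS, hnull⟩ := stub_modelMeasureCoreTools F.S F.hSinj hΛc hcontΛ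
    (fun t ht => (hdyn t ht).1) (fun t ht y hy => hconj t ht y hy) hμc
  -- §9 closed orbits and the enlarged phase
  obtain ⟨R, hR⟩ := stub_closedOrbitClassicalTools hν F xF hxF hU' hbdd hUU' htube
  obtain ⟨K', φ', hKK', hagree, hK', hmem⟩ := stub_enlargedPhaseTools hν hK R
  -- §10 the analytic fields
  obtain ⟨E₂, hclass⟩ := stub_tubeOrbitClassicalTools hν F xF hxF hU' hbdd hUU' htube
  have hclass' : ∀ y ∈ U, ∃ (u : ℝ → (UnitAddTorus (Fin 3)) → (EuclideanSpace ℝ (Fin 3))) (p : ℝ → (UnitAddTorus (Fin 3)) → ℝ),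
      IsClassicalNSSolutionOn (Ioc 0 3) ν (fun _ => force S c) u p ∧ (∀ t ∈ Ioc (0 : ℝ) 3, HasZeroMean (u t)) ∧
      (∀ t ∈ Ioc (0 : ℝ) 3, gradNormSq (u t) ≤ E₂) ∧ ∀ t ∈ Ioc (0 : ℝ) 3, F.S (F.modelMap ν xF U' t y) = stateOf (u t) :=
    fun y hy => by
      obtain ⟨u, p, h1, h2, h3, h4, -, -⟩ := hclass y hy
      exact ⟨u, p, h1, h2, h3, h4⟩
  obtain ⟨h₁, h₁₁, hc₁, hc₁₁⟩ := stub_modelTimeDerivativeFieldsTools hν F xF hxF hU hU' hbdd hUU' htube hcont hclass'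
  -- the y-side fields from T6 (curve packaging of the tube)
  have hT6 := nfinal_yFields F hν xF hU htube hcont hsmooth
  obtain ⟨hW, hc₂₂⟩ := hT6
  obtain ⟨h₂₁, h₁₂, hc₁₂⟩ := stub_modelMixedDerivativeFieldTools hν F xF hxF hU hU' hbdd hUU' htube hcont hsmooth hW hclass'
  have hC2 : ContDiffOn ℝ 2 (fun q : ℝ × Hsp => F.modelMap ν xF U' q.1 q.2) (Ioo (0 : ℝ) 2 ×ˢ U) :=
    (stub_jointSmoothnessTools hU hsmooth h₁ h₁₁ hc₁₁ h₂₁ h₁₂ hc₁₂ hc₂₂).mono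
      (prod_mono (Ioo_subset_Ioo le_rfl (by norm_num)) subset_rfl)
  have hCI := stub_modelDerivativeCompactInjectiveTools hν F xF hxF hU hU' hbdd hUU' htube hsmooth hclass
  have hhyp := stub_hyperbolicityTransferTools hν hK hμ hH F xF hxF hKcK hKc hinv hU hU' hbdd hUU' hΛU htube hcont hsmooth hconj
    hnullΛ hnull
  -- §11 closed orbits are carried onto trajectories of φ' in K'
  have hclosed : ∀ z ∈ U, ∀ T : ℝ, 0 < T → (∀ t ∈ Icc 0 T, F.modelMap ν xF U' t z ∈ U) → F.modelMap ν xF U' T z = z →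
      F.S z ∈ K' ∧ ∀ t : ℝ, 0 ≤ t → φ' t (F.S z) = F.S (F.modelMap ν xF U' t z) :=
    nfinal_closedOrbit F xF hUU' hzero hper hR hK' hmem
  -- §12 assemble
  refine ⟨K', φ', F.S, U, F.S ⁻¹' Kc, F.modelMap ν xF U', mm, hKK', hagree, hK', ?_, ?_⟩
  · exact
      { isOpen := hU
        isCompact := hΛc
        subset := hΛU
        mapsTo := fun t ht => (hdyn t ht).1
        surjOn := fun t ht => (hdyn t ht).2.1
        injOn := fun t ht => (hdyn t ht).2.2
        map_zero := fun x hx => hzero x (hUU' hx)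
        map_add := fun s t hs ht x hx horb => hadd s t hs ht x hx horb
        contDiffOn := hC2
        continuousOn := hcont.mono (prod_mono (Icc_subset_Icc_right (by norm_num)) subset_rfl)
        isCompactOperator_fderiv := fun x hx t ht => (hCI x (hΛU hx) t ⟨ht.1, ht.2.trans (by norm_num)⟩).1
        injective_fderiv := fun x hx t ht => (hCI x (hΛU hx) t ⟨ht.1, ht.2.trans (by norm_num)⟩).2
        prob := hprob
        null_compl := hnullΛ
        map_eq := hmapg
        hyperbolic := hhyp }
  · exact
      { injective := F.hSinj
        image_subset := by rw [hSΛ]; exact hKcK.trans hKK'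
        map_eq := hmapS
        conj := fun t ht y hy => by rw [hconj t ht y hy, hagree t ht _ (hKcK hy)]
        closedOrbit := hclosed }

end Summit.AnomalousDissipation.AnomalousDissipation.Theorems.DenseLoudDesignerForces.Ergodic

end
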